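import Summits.AtomisticToContinuum.Crystallization.Theorems.ChartedPlanarOrderProfileSlavingLJ

/-!
# ChartedPlanarOrder — W_far bookkeeping: heights of tube offsets and Lipschitz moduli of layer forces

decomp-a2c lens-3 (generation 23/24; N = `Theses.ChartedPlanarOrder.ChartedZeroExcessLayered`, PS column; GLUE bricks of
W_far `…TubeMonotoneSplit.FarPairStiffnessL1`, design-neutral).

* §1 `le_inner_offsetOf`: along tube profiles `h i ∈ tube w η i` of a stacking with `⟪ν, incr w i⟫ ≥ h₀` (`‖ν‖ = 1`), the
  offset between layers `k ≤ l` has height `⟪ν, offsetOf h k l⟫ ≥ (l − k)(h₀ − η)`: a span-`s` pair sits `≥ s (h₀ − η)` high.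
* §2 `norm_layerForce_sub_le`: if the per-site pair forces along two offsets `v, v′` differ by `≤ μ ij · ‖v − v′‖` with
  `Σ μ < ∞` (and the two lattice sums converge), then `‖layerForce a b v − layerForce a b v′‖ ≤ (Σ' μ) · ‖v − v′‖`.
The per-site moduli come from `…PairForceLipschitz.pairForce_sub_le` at the floor `max(height, planar distance)`; their
lattice sum (the analytic core, `∼ t⁻⁶` per unit coarea) is generation-24 work.
-/

open Metric Finset
open scoped RealInnerProductSpace
open Summit.AtomisticToContinuum.Crystallization.Theorems.ChartedPlanarOrderRigidityDoor (E3)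
open Summit.AtomisticToContinuum.Crystallization.Theorems.ChartedPlanarOrderProfileSlavingLJ (pairForce layerForce incr offsetOf tube)

namespace Summit.AtomisticToContinuum.Crystallization.Theorems.ChartedPlanarOrderLayerForceLipschitz

/-! ## §1 Heights of tube offsets -/

/-- a tube increment has height at least `h₀ − η`. -/
theorem le_inner_of_mem_tube {ν : E3} {w h : ℤ → E3} {η h₀ : ℝ} (hν : ‖ν‖ = 1) (hh : ∀ i, h i ∈ tube w η i)
    (hw : ∀ i, h₀ ≤ ⟪ν, incr w i⟫) (i : ℤ) : h₀ - η ≤ ⟪ν, h i⟫ := by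
  have hd : ‖h i - incr w i‖ ≤ η := by rw [← dist_eq_norm]; exact mem_closedBall.1 (hh i)
  have h1 : |⟪ν, h i - incr w i⟫| ≤ η := by
    refine (abs_real_inner_le_norm ν _).trans ?_
    rw [hν, one_mul]; exact hd
  have h2 : ⟪ν, h i⟫ = ⟪ν, incr w i⟫ + ⟪ν, h i - incr w i⟫ := by rw [inner_sub_right]; ring
  have h3 := (abs_le.1 h1).1
  have h4 := hw i
  rw [h2]; linarith

/-- ★ HEIGHT OF A TUBE OFFSET: `⟪ν, offsetOf h k l⟫ ≥ (l − k)(h₀ − η)` for `k ≤ l`. -/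
theorem le_inner_offsetOf {ν : E3} {w h : ℤ → E3} {η h₀ : ℝ} (hν : ‖ν‖ = 1) (hh : ∀ i, h i ∈ tube w η i)
    (hw : ∀ i, h₀ ≤ ⟪ν, incr w i⟫) {k l : ℤ} (hkl : k ≤ l) :
    ((l - k : ℤ) : ℝ) * (h₀ - η) ≤ ⟪ν, offsetOf h k l⟫ := by
  rw [offsetOf, inner_sum]
  have hcard : ((Ioc k l).card : ℝ) = ((l - k : ℤ) : ℝ) := by
    rw [Int.card_Ioc]
    have : (0 : ℤ) ≤ l - k := by omega
    exact_mod_cast Int.toNat_of_nonneg this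
  rw [← hcard]
  have := Finset.card_nsmul_le_sum (Ioc k l) (fun i => ⟪ν, h i⟫) (h₀ - η) (fun i _ => le_inner_of_mem_tube hν hh hw i)
  rwa [nsmul_eq_mul] at this

/-- the reading-rule form: with `η ≤ h₀/2`, a span-`s` offset is at height `≥ s·h₀/2`. -/
theorem le_inner_offsetOf_half {ν : E3} {w h : ℤ → E3} {η h₀ : ℝ} (hν : ‖ν‖ = 1) (hh : ∀ i, h i ∈ tube w η i)
    (hw : ∀ i, h₀ ≤ ⟪ν, incr w i⟫) (hη : η ≤ h₀ / 2) {k l : ℤ} (hkl : k ≤ l) :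
    ((l - k : ℤ) : ℝ) * (h₀ / 2) ≤ ⟪ν, offsetOf h k l⟫ := by
  have h1 := le_inner_offsetOf hν hh hw hkl
  have hs : (0 : ℝ) ≤ ((l - k : ℤ) : ℝ) := by exact_mod_cast (show (0 : ℤ) ≤ l - k by omega)
  have : ((l - k : ℤ) : ℝ) * (h₀ / 2) ≤ ((l - k : ℤ) : ℝ) * (h₀ - η) := mul_le_mul_of_nonneg_left (by linarith) hs
  linarith

/-- heights control norms: `⟪ν, x⟫ ≤ ‖x‖` for a unit vector `ν`. -/
theorem inner_le_norm_of_unit {ν : E3} (hν : ‖ν‖ = 1) (x : E3) : ⟪ν, x⟫ ≤ ‖x‖ := by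
  simpa [hν] using real_inner_le_norm ν x

/-! ## §2 Lipschitz moduli of layer forces from per-site moduli -/

/-- ★ LIPSCHITZ MODULUS OF A LAYER FORCE from summable per-site moduli. -/
theorem norm_layerForce_sub_le {a b v v' : E3} {μ : ℤ × ℤ → ℝ} (hμ : Summable μ)
    (hv : Summable fun ij : ℤ × ℤ => pairForce (v + ((ij.1 : ℝ) • a + (ij.2 : ℝ) • b)))
    (hv' : Summable fun ij : ℤ × ℤ => pairForce (v' + ((ij.1 : ℝ) • a + (ij.2 : ℝ) • b)))
    (hle : ∀ ij : ℤ × ℤ, ‖pairForce (v + ((ij.1 : ℝ) • a + (ij.2 : ℝ) • b)) -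
        pairForce (v' + ((ij.1 : ℝ) • a + (ij.2 : ℝ) • b))‖ ≤ μ ij * ‖v - v'‖) :
    ‖layerForce a b v - layerForce a b v'‖ ≤ (∑' ij : ℤ × ℤ, μ ij) * ‖v - v'‖ := by
  have hsum : Summable fun ij : ℤ × ℤ => ‖pairForce (v + ((ij.1 : ℝ) • a + (ij.2 : ℝ) • b)) -
      pairForce (v' + ((ij.1 : ℝ) • a + (ij.2 : ℝ) • b))‖ :=
    Summable.of_nonneg_of_le (fun _ => norm_nonneg _) hle (hμ.mul_right _)
  rw [layerForce, layerForce, ← hv.tsum_sub hv']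
  refine (norm_tsum_le_tsum_norm hsum).trans ?_
  rw [← tsum_mul_right]
  exact hsum.tsum_le_tsum hle (hμ.mul_right _)

/-- the per-site modulus form used downstream: sites with a common floor `r ij ≤ ‖v + ℓ ij‖, ‖v′ + ℓ ij‖` and a modulus
function `Φ` with `‖pairForce x − pairForce y‖ ≤ Φ r · ‖x − y‖` whenever `‖x‖, ‖y‖ ≥ r > 0`. -/
theorem norm_layerForce_sub_le_of_floor {a b v v' : E3} {r : ℤ × ℤ → ℝ} {Φ : ℝ → ℝ}
    (hΦ : ∀ {x y : E3} {t : ℝ}, 0 < t → t ≤ ‖x‖ → t ≤ ‖y‖ → ‖pairForce x - pairForce y‖ ≤ Φ t * ‖x - y‖)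
    (hr : ∀ ij, 0 < r ij) (hrv : ∀ ij : ℤ × ℤ, r ij ≤ ‖v + ((ij.1 : ℝ) • a + (ij.2 : ℝ) • b)‖)
    (hrv' : ∀ ij : ℤ × ℤ, r ij ≤ ‖v' + ((ij.1 : ℝ) • a + (ij.2 : ℝ) • b)‖) (hμ : Summable fun ij => Φ (r ij))
    (hv : Summable fun ij : ℤ × ℤ => pairForce (v + ((ij.1 : ℝ) • a + (ij.2 : ℝ) • b)))
    (hv' : Summable fun ij : ℤ × ℤ => pairForce (v' + ((ij.1 : ℝ) • a + (ij.2 : ℝ) • b))) :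
    ‖layerForce a b v - layerForce a b v'‖ ≤ (∑' ij : ℤ × ℤ, Φ (r ij)) * ‖v - v'‖ := by
  refine norm_layerForce_sub_le hμ hv hv' fun ij => ?_
  have h := hΦ (hr ij) (hrv ij) (hrv' ij)
  rwa [show v + ((ij.1 : ℝ) • a + (ij.2 : ℝ) • b) - (v' + ((ij.1 : ℝ) • a + (ij.2 : ℝ) • b)) = v - v' by abel] at h

end Summit.AtomisticToContinuum.Crystallization.Theorems.ChartedPlanarOrderLayerForceLipschitz
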